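import Summits.AtomisticToContinuum.BoseEinsteinCondensation.Theorems.BoxLabelAffinityB
import HarnessLib

-- PART A (lines 1–327 of lens-6 g34 `land/BoxHorizonAffinity.lean`, sha256 9601ffd153b75c38…); PART B = `BoxHorizonAffinityB`. Split for the 400-line rule by
-- prover hand 1, gen 11 (decomp-a2c LOW lane); declarations byte-identical.

/-!
# «HorizonAffinity» — the label-affinity kernel is SCALE-FREE: lens-6's diagonal residual is ONE number,
# and its weakest placement is the ENERGY HORIZON
# (decomp-a2c · lens-6 «barrier-complement carving» · g34; conjunct `_root_.BoseEinsteinCondensation`)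

Statement decomposed: the conjunct, through the tree's ground-state door
`SoloInformed.hasGroundStateBEC_of_groundState_maxOccupation` — now DISCHARGED BY NAME (`groundStateDoor_holds`,
module built 2026-08-31T13:42Z), so every deciding kernel below has NO hypothesis beyond the typed pieces.
Part I (namespace `…Theorems.BoxLabelAffinity`) is gen 33's «LabelAffinity» with its §T transcript replaced by
imports; Part II (namespace `…Theorems.BoxHorizonAffinity`) is gen 34.  Gen 33's declared residual:
LAB = `GroundStateLabelAffinity` — block-label affinity `≥ c` at the GP scale `ℓ = A/√ρ`.

THE OBSERVATION (§6–§7).  Gen 33's two kernel inequalities give, for every normalised `Φ ≥ 0` and ANY two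
block numbers `K, K'`, the SANDWICH  `labelAffinity(K) − blockDepletion(K)^{1/2} ≤ BC(u_L) ≤ labelAffinity(K')`
(`labelAffinity_le_labelAffinity_add`); and for NESTED partitions label affinity is MONOTONE,
`labelAffinity L (K·j) Φ ≤ labelAffinity L K Φ` (`labelAffinity_mul_le`: Cauchy–Schwarz inside each parent
block; `nestEquiv`, `sum_indicator_nest`, `blockMass_eq_sum_nest`).  Consequences, all PROVED here:
(i) the kernel «`D(K) ≤ s²` ∧ `LAB(K) ≥ c` ⇒ `λ_max ≥ (c−s)²N`» runs at ANY SINGLE scale; (ii) the demand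
«`LAB(K) ≥ c`» is weakest at the COARSEST scale whose depletion is energy-controlled — the energy horizon;
(iii) once the depletion is small at one scale `K`, ALL label affinities at ALL scales agree up to `√D(K)`:
the diagonal residual of lens-6 is ONE scale-free number, and the scale axis is EXHAUSTED —
`horizonLabelAffinity_of_labelAffinity : LAB → LAB_h(η)` (unconditional) and
`labelAffinity_of_horizonPieces : LOC_h(η) → LAB_h(η) → LAB` (converse modulo the energy-class piece).

PIECES (§9; parameter `η : ℝ≥0`; HORIZON WINDOW = tree `InWindow` with constant `Mρ^{-η}`, i.e. block side
`L/K ∈ [Mρ^{-η}/√ρ, 2Mρ^{-η}/√ρ]`; at `η = 0` every piece IS gen 33's: `horizonCondensation_zero_iff`,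
`horizonLabelAffinity_zero_iff`):
* LOC_h(η) = `GroundStateHorizonCondensation η` — block depletion `≤ s` on horizon blocks (ENERGY-CLASS ·
  FACT-BACKED for `η < 1/4 + η_J/2` by [Junge2026 Cor. 6 (26)] = tree fact `Junge2026_neumannLargeBox_pinnedLowerBound`
  · TRUE-type · WEAKER · ATTACKABLE·L);
* TSD(η) = `GroundStateTwoScaleDepletion η` — `D(K) ≤ D(K·j) + s` from a horizon `K` to a nested GP `K·j`
  (ENERGY-CLASS · the density-currency form of g31's `HorizonLocalDepletion` LD, which gives it for `η ≤ 1/4` ·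
  WEAKER · ATTACKABLE·L); `horizonCondensation_of_loc_twoScale : LOC → TSD(η) → LOC_h(η)`;
* LAB_h(η) = `GroundStateHorizonLabelAffinity η` — label affinity `≥ c` on horizon blocks (DECLARED RESIDUAL ·
  UNDECIDED-DIAGONAL · IDEA-NEEDED · WEAKER than LAB by `horizonLabelAffinity_of_labelAffinity`, monotone in `η`
  by `horizonLabelAffinity_mono`).
KERNELS (0 sorry, axioms standard): `bec_of_horizonAffinity₀ η : UGS → LOC_h(η) → LAB_h(η) → BoseEinsteinCondensation`;
assembled `bec_of_twoScaleAffinity₀ η : UGS → LOC → TSD(η) → LAB_h(η) → BoseEinsteinCondensation`; the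
door-hypothesis forms `bec_of_horizonAffinity`, `bec_of_twoScaleAffinity`, and gen 33's `bec_of_labelAffinity₀`.
INSTANCE OF RECORD: `η = 1/4` (inside every admissible range, independent of Junge's `η_J`): horizon blocks of
side `ℓ_h = Mρ^{-3/4}` (`= M'ξ(ρa³)^{-1/4}` in healing lengths), `ρℓ_h³ ≍ ρ^{-5/4} → ∞` particles each,
`K_h³ = N/(ρℓ_h³) → ∞` blocks; UGS (KNOWN·M, Reed–Simon XIII.47 + connected hard-core complement).

WHY WEAKER, AND EXACTLY HOW MUCH (doctrine score).  LAB ⇒ LAB_h(η) is a theorem (refine the horizon window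
into the GP window, `exists_mul_inWindow`, then `labelAffinity_mul_le`).  LAB_h(η) alone ⇏ LAB: a state whose
conditional block law is uniform over horizon blocks but concentrated on one environment-chosen GP sub-block
inside each has `LAB_h = 1`, `LAB = j^{-3/2} → 0` (probe P4 fails to close it cheaply).  LAB_h(η) ⇏ the
conjunct (horizon-block-wise phase disorder keeps LAB_h and TSD, kills BEC); UGS ∧ LOC ∧ TSD ⇏ the conjunct
without LAB_h (probe P5).  The converse LAB_h(η) ∧ LOC_h(η) ⇒ LAB is `labelAffinity_of_horizonPieces`: the
implication's converse costs EXACTLY the energy-class piece — every scale-dependent part of the diagonal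
residual has been moved into the energy class, and nothing on the scale axis inside the energy-sighted region
is weaker than LAB_h.  Above the horizon (`η ≥ 1/4 + η_J/2`) LOC_h itself leaves print and becomes a second
residual; that is where this carving stops.

READING OF THE RESIDUAL (information / point-process language; dictionary explicit).  With `π_h(·|Y)` the
conditional law of particle 1's HORIZON CELL given the other `N−1` positions under `|Ψ₀|²`,
`LAB_h = E_{Y∼P̂} BC(π_h(·|Y), unif_{K_h³})` — bounded Rényi-½ dependence between one particle's horizon cell
and its environment.  Sufficient: bounded KL / mutual information AT HORIZON-CELL RESOLUTION (Jensen
`BC ≥ e^{-KL/2}`, tree `exp_neg_klDiv_div_two_le_lintegral_sqrt`); the solo-blind Line I feeds the FULL-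
resolution dependence into the flat mode (tree `mul_exp_neg_le_maxOccupation_of_mutualInfo_le`) and meets its
wall («lemma M») at the gap scale — by data processing the horizon-cell dependence is the SMALLEST member of
that family, two scales coarser than the wall.  Point-process form: a quantitative condition (Σ) / insertion
tolerance of the Papangelou kernel of `|Ψ₀|²` at scale `ℓ_h` [Karr2017 §2.5; GhoshPeres2017].  Contrapositive
of gen 33's `flatAffinity_le_labelAffinity`: flat-mode BEC of a nonnegative ground state forces
`LAB(K) ≥ BC(u_L)` at EVERY scale — Hellinger NUMBER-RIGIDITY of `|Ψ₀|²` at any mesoscopic scale would REFUTE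
the conjunct; so LAB_h is implied by the conjunct and is TRUE-type.  Status in print: bosonic ground states are
hyperuniform (`S(k) ∝ k`, Feynman–Cohen; [Torquato2016 p.4]), and in `d = 3` hyperuniformity does not force
rigidity (Gaussian-perturbed lattices, Peres–Sly arXiv:1409.4490; hierarchical Coulomb gases, Chatterjee
arXiv:1708.01965, Ganguly–Sarkar arXiv:1904.05321) — tolerance of `|Ψ₀|²` for interacting continuum bosons is
undecided at every scale; heuristically (Jastrow × Reatto–Chester tails `u ∼ α/r²`) the cell-averaged insertion
field has fluctuations `≲ ρα²/ℓ_h → 0`, i.e. `1 − LAB_h → 0`.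

WHY NOVEL (problem-relative).  g30/g31 found the horizon on the ENERGY axis (NEAR/FAR; FAR's residual WIT is a
COHERENCE statement); g33 found the conditional-law axis at the GP scale.  New here: (a) the sandwich and the
refinement monotonicity, which make «the diagonal residual is one scale-free number; put it at the horizon» a
THEOREM (both directions typed and proved); (b) TSD typed in the density currency, joining g31's Junge-backed LD
to g33's kernel with none of DOM/COH/LIP/WIT; (c) LAB_h: the first typed residual of the cell that is at once
diagonal-only (outside every energy/gap/RP/cycle barrier class) AND placed at the edge of the energy-sighted
region; (d) the door discharged: `bec_of_horizonAffinity₀` / `bec_of_labelAffinity₀` have no non-piece hypotheses.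

BARRIER PLACEMENT.  LOC_h, TSD: INSIDE the energy method's sighted region by construction (`R < R_E`,
[Junge2026 Remark 7]; `KineticGapLengthScalesNarrow` caveat (e) is the horizon and they stop below it).  LAB_h:
`EnergyAsymptoticsWithoutCondensation{,Narrow}` — OUTSIDE (not an energy asymptotic; a property of `|Ψ₀|²`);
`KineticGapLengthScales{,Narrow,ThermodynamicWindow,ModeFree,DirichletWindow}` — OUTSIDE (no energy window is
quantified; the witnesses of those barriers are energy-degenerate families, LAB_h reads the Perron–Frobenius
state only); `BogoliubovPerturbationInfrared` — OUTSIDE (no expansion); `FeynmanCyclesVersusCondensation`,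
`HalfFilling*`, `CasimirBoxGeneralizedCondensation` — do not quantify over conditional laws of the ground-state
density; `SutoDegenerateGroundStates` — discharged by UGS.  Honest bet: LAB_h needs a NEW positivity / tolerance
input for `|Ψ₀|²` (Feynman–Kac line insertion at scale `ℓ_h`, or a DLR/(Σ)-structure of the ground-state
measure) — not in print.

All statements are over tree declarations (`IsGroundState`, `groundState`, `HasUniqueGroundState`,
`maxOccupation`, `sideLength`, `InWindow`, `subCell`, `SubIdx`, `scatteringLength`) and Part I's `labelAffinity`,
`blockDepletion`.  No `sorry`, no new axioms; `@[conjecture]` marks the pieces (DOOR keeps gen 33's tag but is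
proved in-file).
-/

noncomputable section

open MeasureTheory Filter Set
open scoped ENNReal NNReal BigOperators


/-! ## Part II — g34 «HorizonAffinity»: the kernel is scale-free; the residual moves to the energy horizon

(namespace `…Theorems.BoxHorizonAffinity`; everything below is NEW in gen 34 and uses Part I by name.) -/

namespace Summit.AtomisticToContinuum.BoseEinsteinCondensation.Theorems.BoxHorizonAffinity

open Literature.MathematicalPhysics.QuantumManyBody.BoseGas
open Summit.AtomisticToContinuum.BoseEinsteinCondensation.Theorems.BoxLatticeFSum
open Summit.AtomisticToContinuum.BoseEinsteinCondensation.Theorems.BoxLabelAffinity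

variable {n : ℕ}

/-! ### §6  Two scales compared in ONE step (no nesting): `LAB(K) ≤ LAB(K') + √D(K)` -/

/-- **Scale-freeness of the g33 kernel.**  For a normalised amplitude and ANY two block numbers `K, K'`:
`labelAffinity L K Φ ≤ labelAffinity L K' Φ + (blockDepletion L K Φ)^{1/2}` — both sides pass through the
global flat affinity `BC(u_L)` (`labelAffinity_le_affinity_add` at `K`, `flatAffinity_le_labelAffinity` at
`K'`).  Consequence: the kernel `mul_sq_le_maxOccupation` may be applied at ANY single scale at which the block
depletion is controlled — in particular at the coarsest such scale, the energy horizon. [folklore] -/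
theorem labelAffinity_le_labelAffinity_add {L : ℝ} {K K' : ℕ} (hL : 0 < L) (hK : 0 < K) (hK' : 0 < K')
    {Φ : Config (n + 1) → ℝ} (hΦm : Measurable Φ)
    (hΦ1 : ∫⁻ Y : Config n, ∫⁻ x, ENNReal.ofReal (Φ (Matrix.vecCons x Y)) ^ 2 = 1) :
    labelAffinity L K Φ ≤ labelAffinity L K' Φ + blockDepletion L K Φ ^ (1 / 2 : ℝ) :=
  (labelAffinity_le_affinity_add hL hK hΦm hΦ1).trans
    (add_le_add (flatAffinity_le_labelAffinity hL hK' hΦm) le_rfl)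

/-! ### §7  Nested block partitions and REFINEMENT MONOTONICITY of the label affinity

`P_{Kj}³` refines `P_K³`: the fine block with coordinates `r_i + j·P_i` (`P ∈ P_K³`, `r ∈ P_j³`) is the
`r`-th child of the coarse block `P`, and `Q_P = ⊔_r Q_{child(P,r)}`.  Hellinger affinity to the uniform
law can only DECREASE under refinement (Cauchy–Schwarz inside each parent), so
`labelAffinity L (K·j) Φ ≤ labelAffinity L K Φ`: label affinity at a COARSER scale is the WEAKER demand. -/

/-- Child indexing of the nested partitions: `(P, r) ↦ (i ↦ r_i + j·P_i)`, an equivalence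
`P_K³ × P_j³ ≃ P_{Kj}³` (coordinatewise `finProdFinEquiv`). [folklore] -/
def nestEquiv (K j : ℕ) : SubIdx K × SubIdx j ≃ SubIdx (K * j) where
  toFun p := fun i => finProdFinEquiv (p.1 i, p.2 i)
  invFun q := (fun i => (finProdFinEquiv.symm (q i)).1, fun i => (finProdFinEquiv.symm (q i)).2)
  left_inv p := by
    obtain ⟨P, r⟩ := p
    refine Prod.ext ?_ ?_ <;> funext i <;> simp only [Equiv.symm_apply_apply]
  right_inv q := by
    funext i
    simp only [Prod.mk.eta, Equiv.apply_symm_apply]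

/-- Coordinates of a child block: `r_i + j·P_i`. [folklore] -/
theorem nestEquiv_apply_val (K j : ℕ) (P : SubIdx K) (r : SubIdx j) (i : Fin 3) :
    ((nestEquiv K j (P, r) i : Fin (K * j)) : ℕ) = (r i : ℕ) + j * (P i : ℕ) := by
  simp [nestEquiv]

variable {K j : ℕ} {ℓ : ℝ}

/-- Membership in a child block, read relative to the corner `jℓ·P` of its parent. [folklore] -/
theorem mem_subCell_nest_iff (P : SubIdx K) (r : SubIdx j) (x : Space) :
    x ∈ subCell ℓ (nestEquiv K j (P, r)) ↔ x - subOffset ((j : ℝ) * ℓ) P ∈ subCell ℓ r := by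
  rw [mem_subCell, mem_subCell]
  refine forall_congr' fun i => ?_
  have hv : ℓ * (((nestEquiv K j (P, r) i : Fin (K * j)) : ℕ) : ℝ) =
      ℓ * ((r i : ℕ) : ℝ) + (j : ℝ) * ℓ * ((P i : ℕ) : ℝ) := by
    rw [nestEquiv_apply_val]; push_cast; ring
  rw [hv, PiLp.sub_apply, subOffset_apply]
  constructor <;> rintro ⟨h1, h2⟩ <;> constructor <;> linarith

/-- **The children tile the parent**: `Σ_r 1_{Q_{child(P,r)}} h = 1_{Q_P} h` pointwise, where the parent
has side `jℓ` (tree `sum_indicator_subCell`, translated to the parent's corner). [folklore] -/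
theorem sum_indicator_nest (hℓ : 0 < ℓ) (P : SubIdx K) (h : Space → ℝ≥0∞) (x : Space) :
    ∑ r : SubIdx j, (subCell ℓ (nestEquiv K j (P, r))).indicator h x =
      (subCell ((j : ℝ) * ℓ) P).indicator h x := by
  set a : Space := subOffset ((j : ℝ) * ℓ) P with ha
  have hP : x ∈ subCell ((j : ℝ) * ℓ) P ↔ x - a ∈ cell ((j : ℝ) * ℓ) := Iff.rfl
  have e1 : ∀ r : SubIdx j, (subCell ℓ (nestEquiv K j (P, r))).indicator h x =
      (subCell ℓ r).indicator (fun y => h (y + a)) (x - a) := by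
    intro r
    by_cases hx : x ∈ subCell ℓ (nestEquiv K j (P, r))
    · rw [Set.indicator_of_mem hx, Set.indicator_of_mem ((mem_subCell_nest_iff P r x).1 hx),
        sub_add_cancel]
    · rw [Set.indicator_of_notMem hx,
        Set.indicator_of_notMem (fun h' => hx ((mem_subCell_nest_iff P r x).2 h'))]
  have e2 : (subCell ((j : ℝ) * ℓ) P).indicator h x =
      (cell ((j : ℝ) * ℓ)).indicator (fun y => h (y + a)) (x - a) := by
    by_cases hx : x ∈ subCell ((j : ℝ) * ℓ) P
    · rw [Set.indicator_of_mem hx, Set.indicator_of_mem (hP.1 hx), sub_add_cancel]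
    · rw [Set.indicator_of_notMem hx, Set.indicator_of_notMem (fun h' => hx (hP.2 h'))]
  simp_rw [e1]
  rw [sum_indicator_subCell hℓ (fun y => h (y + a)) (x - a), e2]

/-- **Coarse block mass = sum of the children's block masses** (`q_P = Σ_r q_{child(P,r)}`). [folklore] -/
theorem blockMass_eq_sum_nest {L : ℝ} (hL : 0 < L) (hK : 0 < K) (hj : 0 < j)
    {Φ : Config (n + 1) → ℝ} (hΦm : Measurable Φ) (P : SubIdx K) (Y : Config n) :
    blockMass L K Φ P Y = ∑ r : SubIdx j, blockMass L (K * j) Φ (nestEquiv K j (P, r)) Y := by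
  have hKr : (0 : ℝ) < K := by exact_mod_cast hK
  have hjr : (0 : ℝ) < j := by exact_mod_cast hj
  have hKj : (0 : ℝ) < ((K * j : ℕ) : ℝ) := by exact_mod_cast Nat.mul_pos hK hj
  have hℓ : 0 < L / ((K * j : ℕ) : ℝ) := div_pos hL hKj
  have hcoarse : L / (K : ℝ) = (j : ℝ) * (L / ((K * j : ℕ) : ℝ)) := by
    rw [Nat.cast_mul]; field_simp
  have hF : Measurable fun x => ENNReal.ofReal (Φ (Matrix.vecCons x Y)) ^ 2 :=
    ((measurable_uncurry_slice hΦm).pow_const 2).comp (measurable_id.prodMk measurable_const)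
  unfold blockMass
  rw [hcoarse, ← lintegral_indicator (measurableSet_subCell _ P)]
  simp_rw [← sum_indicator_nest hℓ P]
  rw [lintegral_finsetSum _ fun r _ => hF.indicator (measurableSet_subCell _ _)]
  exact Finset.sum_congr rfl fun r _ => lintegral_indicator (measurableSet_subCell _ _) _

/-- The weights are consistent: `Σ_{r ∈ P_j³} w_{Kj}² = j³ (Kj)⁻³ = K⁻³ = w_K²`. [folklore] -/
theorem sum_blockWeight_nest_sq (hK : 0 < K) (hj : 0 < j) :
    ∑ _r : SubIdx j, blockWeight (K * j) ^ 2 = blockWeight K ^ 2 := by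
  have hKr : (0 : ℝ) < K := by exact_mod_cast hK
  have hjr : (0 : ℝ) < j := by exact_mod_cast hj
  have h1 : ∀ {m : ℕ}, 0 < m → blockWeight m ^ 2 = ENNReal.ofReal (((m : ℝ) ^ 3)⁻¹) := by
    intro m hm
    have hmr : (0 : ℝ) < m := by exact_mod_cast hm
    rw [blockWeight, ← ENNReal.ofReal_pow (by positivity)]
    congr 1
    rw [← pow_mul, show 3 * 2 = 2 * 3 by norm_num, pow_mul, Real.sq_sqrt (by positivity), one_div,
      inv_pow]
  rw [Finset.sum_const, Finset.card_univ, show Fintype.card (SubIdx j) = j ^ 3 by simp, nsmul_eq_mul,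
    h1 (Nat.mul_pos hK hj), h1 hK,
    show ((j ^ 3 : ℕ) : ℝ≥0∞) = ENNReal.ofReal ((j : ℝ) ^ 3) by
      rw [← ENNReal.ofReal_natCast, Nat.cast_pow],
    ← ENNReal.ofReal_mul (by positivity)]
  congr 1
  push_cast
  field_simp

/-- **Cauchy–Schwarz inside one parent**: `Σ_r w_{Kj} √q_{child(P,r)} ≤ w_K √q_P`. [folklore] -/
theorem sum_nest_sqrt_le {L : ℝ} (hL : 0 < L) (hK : 0 < K) (hj : 0 < j)
    {Φ : Config (n + 1) → ℝ} (hΦm : Measurable Φ) (P : SubIdx K) (Y : Config n) :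
    ∑ r : SubIdx j, blockWeight (K * j) *
        blockMass L (K * j) Φ (nestEquiv K j (P, r)) Y ^ (1 / 2 : ℝ) ≤
      blockWeight K * blockMass L K Φ P Y ^ (1 / 2 : ℝ) := by
  have rpow_half_sq : ∀ m : ℝ≥0∞, (m ^ 2) ^ (1 / 2 : ℝ) = m := fun m => by
    rw [← ENNReal.rpow_two, ← ENNReal.rpow_mul]; norm_num
  calc ∑ r : SubIdx j, blockWeight (K * j) *
        blockMass L (K * j) Φ (nestEquiv K j (P, r)) Y ^ (1 / 2 : ℝ)
      ≤ (∑ _r : SubIdx j, blockWeight (K * j) ^ 2) ^ (1 / 2 : ℝ) *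
          (∑ r : SubIdx j, blockMass L (K * j) Φ (nestEquiv K j (P, r)) Y) ^ (1 / 2 : ℝ) :=
        sum_mul_rpow_half_le _ (fun _ => blockWeight (K * j))
          (fun r => blockMass L (K * j) Φ (nestEquiv K j (P, r)) Y)
    _ = blockWeight K * blockMass L K Φ P Y ^ (1 / 2 : ℝ) := by
        rw [sum_blockWeight_nest_sq hK hj, rpow_half_sq, ← blockMass_eq_sum_nest hL hK hj hΦm P Y]

/-- **REFINEMENT MONOTONICITY**: `labelAffinity L (K·j) Φ ≤ labelAffinity L K Φ` — the label affinity at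
a coarser scale dominates the one at any nested finer scale (for every measurable `Φ`, no normalisation).
Hence «label affinity `≥ c` at the COARSE scale» is implied by, i.e. WEAKER than, the same at the fine
scale. [folklore] -/
theorem labelAffinity_mul_le {L : ℝ} (hL : 0 < L) (hK : 0 < K) (hj : 0 < j)
    {Φ : Config (n + 1) → ℝ} (hΦm : Measurable Φ) :
    labelAffinity L (K * j) Φ ≤ labelAffinity L K Φ := by
  unfold labelAffinity
  refine lintegral_mono fun Y => ?_
  refine mul_le_mul' le_rfl ?_
  rw [← Fintype.sum_equiv (nestEquiv K j)
      (fun p => blockWeight (K * j) * blockMass L (K * j) Φ (nestEquiv K j p) Y ^ (1 / 2 : ℝ))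
      (fun q => blockWeight (K * j) * blockMass L (K * j) Φ q Y ^ (1 / 2 : ℝ)) (fun _ => rfl),
    Fintype.sum_prod_type]
  exact Finset.sum_le_sum fun P _ => sum_nest_sqrt_le hL hK hj hΦm P Y

/-! ### §8  Window arithmetic: from a coarse window down to the GP window along a nested refinement -/

/-- A window forces `L > 0`. [folklore] -/
theorem sideLength_pos_of_inWindow {A ρ L : ℝ} {K : ℕ} (hA : 0 < A) (hρ : 0 < ρ) (hK : 0 < K)
    (hw : InWindow A ρ L K) : 0 < L := by
  have hsr : 0 < Real.sqrt ρ := Real.sqrt_pos.2 hρ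
  have hKr : (0 : ℝ) < K := by exact_mod_cast hK
  have h1 : 0 < A / Real.sqrt ρ := div_pos hA hsr
  have h2 : 0 < L / (K : ℝ) := h1.trans_le hw.1
  by_contra h
  push Not at h
  have : L / (K : ℝ) ≤ 0 := div_nonpos_of_nonpos_of_nonneg h hKr.le
  linarith

/-- **Nested refinement into the GP window.**  If `L/K` lies in the window of constant `A' ≥ A`, some
multiple `K·j` (`j = ⌈L√ρ/(2AK)⌉ ≥ 1`) has `L/(Kj)` in the window of constant `A` (an interval `[X, 2X]`
with `X ≥ 1/2` contains `⌈X⌉`). [folklore] -/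
theorem exists_mul_inWindow {A A' ρ L : ℝ} {K : ℕ} (hA : 0 < A) (hAA' : A ≤ A') (hρ : 0 < ρ)
    (hK : 0 < K) (hw : InWindow A' ρ L K) : ∃ j : ℕ, 0 < j ∧ InWindow A ρ L (K * j) := by
  obtain ⟨hlo, hhi⟩ := hw
  have hsr : 0 < Real.sqrt ρ := Real.sqrt_pos.2 hρ
  have hKr : (0 : ℝ) < K := by exact_mod_cast hK
  -- `ℓ = L/K ≥ A'/√ρ ≥ A/√ρ`, so `X := ℓ√ρ/(2A) ≥ 1/2`
  obtain ⟨ℓ, hℓdef⟩ : ∃ ℓ : ℝ, ℓ = L / (K : ℝ) := ⟨_, rfl⟩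
  rw [← hℓdef] at hlo hhi
  have hℓA : A ≤ ℓ * Real.sqrt ρ := by
    have : A / Real.sqrt ρ ≤ ℓ := (div_le_div_of_nonneg_right hAA' hsr.le).trans hlo
    rwa [div_le_iff₀ hsr] at this
  obtain ⟨X, hXdef⟩ : ∃ X : ℝ, X = ℓ * Real.sqrt ρ / (2 * A) := ⟨_, rfl⟩
  have hX : 1 / 2 ≤ X := by
    rw [hXdef, le_div_iff₀ (by positivity)]; linarith
  have hX0 : 0 < X := by linarith
  obtain ⟨j, hjdef⟩ : ∃ j : ℕ, j = ⌈X⌉₊ := ⟨_, rfl⟩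
  have hj1 : X ≤ (j : ℝ) := by rw [hjdef]; exact Nat.le_ceil X
  have hj2 : (j : ℝ) ≤ 2 * X := by
    rcases le_or_gt 1 X with h1 | h1
    · have := Nat.ceil_lt_add_one hX0.le
      rw [← hjdef] at this
      linarith
    · have hj_eq : j = 1 := by
        rw [hjdef, Nat.ceil_eq_iff one_ne_zero]
        norm_num
        exact ⟨hX0, h1.le⟩
      rw [hj_eq]; push_cast; linarith
  have hjpos : 0 < j := by rw [hjdef]; exact Nat.ceil_pos.2 hX0
  have hjr : (0 : ℝ) < j := by exact_mod_cast hjpos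
  have hℓj : L / ((K * j : ℕ) : ℝ) = ℓ / (j : ℝ) := by
    rw [hℓdef, Nat.cast_mul, div_div]
  refine ⟨j, hjpos, ?_, ?_⟩
  · -- `A/√ρ ≤ ℓ/j` ⟸ `j ≤ 2X = ℓ√ρ/A`
    rw [hℓj, div_le_div_iff₀ hsr hjr]
    have : (j : ℝ) * A ≤ 2 * X * A := mul_le_mul_of_nonneg_right hj2 hA.le
    have h2X : 2 * X * A = ℓ * Real.sqrt ρ := by rw [hXdef]; field_simp
    linarith
  · -- `ℓ/j ≤ 2A/√ρ` ⟸ `X ≤ j`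
    rw [hℓj, div_le_div_iff₀ hjr hsr]
    have : X * (2 * A) ≤ (j : ℝ) * (2 * A) := mul_le_mul_of_nonneg_right hj1 (by positivity)
    have hX2 : X * (2 * A) = ℓ * Real.sqrt ρ := by rw [hXdef]; field_simp
    linarith

/-- For `ρ ≤ 1` and `η ≤ η'` the window constant `Mρ^{-η'}` dominates `Mρ^{-η}`. [folklore] -/
theorem mul_rpow_neg_mono {M ρ η η' : ℝ} (hM : 0 ≤ M) (hρ : 0 < ρ) (hρ1 : ρ ≤ 1) (h : η ≤ η') :
    M * ρ ^ (-η) ≤ M * ρ ^ (-η') :=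
  mul_le_mul_of_nonneg_left (Real.rpow_le_rpow_of_exponent_ge hρ hρ1 (neg_le_neg h)) hM

end Summit.AtomisticToContinuum.BoseEinsteinCondensation.Theorems.BoxHorizonAffinity
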